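import Literature.AlgebraicGeometry.HodgeTheory.SpecialLinearIdentityComponent
import Literature.AlgebraicGeometry.HodgeTheory.UnitaryGroupZariskiDense
import Literature.AlgebraicGeometry.HodgeTheory.UnitaryReflectionCommutatorsZariski
import Literature.AlgebraicGeometry.HodgeTheory.GoursatKolchinRibetCriterion
import HarnessLib

/-!
# If the commutators of a unitary group lie in `Γ^Zar(ℂ)`, then `SL ⊆ (Γ^Zar)°(ℂ)` — the per-eigenspace input
# of the Goursat–Kolchin–Ribet step for cyclic-cover monodromy (Borel I.2.2–2.4, 18.3; Carlson–Toledo 1999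
# §7; Katz 1990 Prop. 1.8.2 hypothesis (1))

Family `hodge`, layer `Literature/AlgebraicGeometry/HodgeTheory`. THEOREMS assembling
`UnitaryGroupZariskiDense` (`U(W,h)` is ℂ-Zariski dense in `GL(W)`), `GlZariskiClosureGroup`
(`⁅Ā, B̄⁆ ⊆ Zar ⁅A, B⁆`, Borel I.2.4), `SpecialLinearIdentityComponent` (`(GL, GL) = SL`, `SL` connected, on
points) and the landed complex-points form of Carlson–Toledo's density theorem
(`commutator_mem_glZariskiClosure_of_prime_order`). Written by the prover seat `hodge-nonav-prover-A` (cell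
`hodge-nonav`) for the crux K1 `VeryGeneralDeckCommutatorsInHg` of
`Summits/HodgeConjecture/HodgeConjecture/Theses/CyclicUnitaryPowers.lean` (`stmt-HodgeConjecture-19544`):
it is residual (c) of the lane-D roadmap (memo LANE-D-ROADMAP-Ax-g0 §2), i.e. hypothesis (1) of
`Katz1990_goursatKolchinRibet_specialLinear` in the consumable form (1′)
"`SL(Eⱼ)(ℂ) ⊆ glIdentityComponent (ρⱼ Γ)`", established for every eigenspace `Eⱼ = H(ζ^j)` of the deck
transformation from the per-place input "`[U(hⱼ), U(hⱼ)] ⊆ (ρⱼ Γ)^Zar(ℂ)`".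

## What is proved (`W` finite-dimensional complex, `B` non-degenerate hermitian, `Γ ≤ GL(W)` any subgroup)
* `commutator_mem_glZariskiClosure_of_unitary_commutators` — if `u₁ u₂ u₁⁻¹ u₂⁻¹ ∈ Γ^Zar(ℂ)` for all
  `B`-unitary `u₁, u₂`, then `g h g⁻¹ h⁻¹ ∈ Γ^Zar(ℂ)` for ALL `g, h ∈ GL(W)` (density + Borel I.2.4).
* `mem_glZariskiClosure_of_det_eq_one_of_unitary_commutators` — … hence `SL(W)(ℂ) ⊆ Γ^Zar(ℂ)`.
* **`mem_glIdentityComponent_of_det_eq_one_of_unitary_commutators`** — … hence `SL(W)(ℂ) ⊆ (Γ^Zar)°(ℂ)`.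
* **`specialLinear_subset_glIdentityComponent_of_unitary_commutators_holds`** — DISCHARGE of the named fact
  `specialLinear_subset_glIdentityComponent_of_unitary_commutators` of `GoursatKolchinRibetCriterion` §2 (its
  `-- TODO(proof)`: "provable … by the Cayley transform … not attempted here" — done in
  `UnitaryGroupZariskiDense`); hence `Katz1990_goursatKolchinRibet_specialLinear'.of_unitary_commutators'`,
  the (1″)-shaped criterion modulo the Katz fact ALONE.
* **`carlsonToledo1999_unitaryReflection_zariskiDense.mem_glIdentityComponent_of_det_eq_one`** — under the
  hypotheses of Carlson–Toledo's Theorem `udensitytheo` with `λ` of prime order `p ≥ 7` (a `Γ`-stable,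
  `Γ`-transitive, spanning set `Δ` of vectors with `h(δ,δ) = ε = ±1`, `Γ` generated by the `λ`-reflections
  along `Δ`, `dim W ≥ 2`): EVERY determinant-one automorphism of `W` lies in `glIdentityComponent Γ`, modulo
  the cited fact `carlsonToledo1999_unitaryReflection_zariskiDense` ("`SU(W,h) ⊆ (Γ^Zar)°`, indeed
  `SL(W) ⊆ (Γ^Zar)°(ℂ)`" — the TODO of `UnitaryReflectionGroupZariskiDense`).

## References
* [Borel1991] A. Borel, *Linear Algebraic Groups*, 2nd ed., GTM 126 (1991), I.2.2–I.2.4, 18.3.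
* [CarlsonToledo1999] J. A. Carlson, D. Toledo, *Discriminant complements and kernels of monodromy
  representations*, Duke Math. J. 97 (1999), §7 Theorem `udensitytheo`.
* [Katz1990ESDE] N. M. Katz, *Exponential Sums and Differential Equations*, Ann. of Math. Stud. 124 (1990),
  §1.8 Prop. 1.8.2 (hypothesis (1): `Gᵢ^{0,der} = SL(Vᵢ)`).
* [Springer1998] T. A. Springer, *Linear Algebraic Groups*, 2nd ed. (1998), 13.3.9 (ii) (density of real
  points), 2.2.1–2.2.5.
* [CarlsonMullerStachPeters2017] J. Carlson, S. Müller-Stach, C. Peters, *Period Mappings and Period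
  Domains*, 2nd ed. (2017), Lemma–Definition 15.3.7 (the vocabulary `Γ^Zar`, `Mon = (Γ^Zar)°`).
-/

noncomputable section

open Literature.AlgebraicGeometry.Motives Module

namespace Literature.AlgebraicGeometry.HodgeTheory

variable {W : Type} [AddCommGroup W] [Module ℂ W] [FiniteDimensional ℂ W] {B : W →ₗ⋆[ℂ] W →ₗ[ℂ] ℂ}

/-- **`[U(h), U(h)] ⊆ Γ^Zar(ℂ) ⇒ (GL(W), GL(W)) ⊆ Γ^Zar(ℂ)`**: the unitary group is Zariski dense in
`GL(W)` (`mem_glZariskiClosure_of_forall_isometry_mem`) and commutators of closure points lie in the closure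
of the commutators (Borel I.2.4, `commutator_mem_glZariskiClosure`). [cite: Borel1991, I.2.4 and 18.3] -/
theorem commutator_mem_glZariskiClosure_of_unitary_commutators (hB : B.IsSymm) (hBn : B.Nondegenerate)
    {Γ : Subgroup (W ≃ₗ[ℂ] W)}
    (hcomm : ∀ u₁ u₂ : W ≃ₗ[ℂ] W, (∀ x y, B (u₁ x) (u₁ y) = B x y) → (∀ x y, B (u₂ x) (u₂ y) = B x y) →
      u₁ * u₂ * u₁⁻¹ * u₂⁻¹ ∈ glZariskiClosure Γ)
    (g h : W ≃ₗ[ℂ] W) : g * h * g⁻¹ * h⁻¹ ∈ glZariskiClosure Γ := by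
  -- the unitary group of `B` as a subgroup of `GL(W)`
  let U : Subgroup (W ≃ₗ[ℂ] W) :=
    { carrier := {u | ∀ x y, B (u x) (u y) = B x y}
      mul_mem' := fun {u v} hu hv x y => by rw [LinearEquiv.mul_apply, LinearEquiv.mul_apply, hu, hv]
      one_mem' := fun x y => rfl
      inv_mem' := fun {u} hu x y => by
        have h := hu (u⁻¹ x) (u⁻¹ y)
        rw [← LinearEquiv.mul_apply, ← LinearEquiv.mul_apply, mul_inv_cancel] at h
        exact h.symm }
  have hdense : ∀ k : W ≃ₗ[ℂ] W, k ∈ glZariskiClosure U :=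
    mem_glZariskiClosure_of_forall_isometry_mem hB hBn (Δ := U) fun u hu => hu
  have hc := commutator_mem_glZariskiClosure (Δ₁ := U) (Δ₂ := U) (Δ := glZariskiClosureSubgroup Γ)
    (fun a ha c hc => (mem_glZariskiClosureSubgroup_iff Γ _).2 (hcomm a c ha hc)) (hdense g) (hdense h)
  rwa [glZariskiClosure_glZariskiClosureSubgroup] at hc

/-- **`[U(h), U(h)] ⊆ Γ^Zar(ℂ) ⇒ SL(W)(ℂ) ⊆ Γ^Zar(ℂ)`** (`(GL, GL) ⊇` generators of `SL`,
`mem_glZariskiClosure_of_det_eq_one_of_commutators`). [cite: Borel1991, I.2.3 and 18.3] -/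
theorem mem_glZariskiClosure_of_det_eq_one_of_unitary_commutators (hB : B.IsSymm) (hBn : B.Nondegenerate)
    {Γ : Subgroup (W ≃ₗ[ℂ] W)}
    (hcomm : ∀ u₁ u₂ : W ≃ₗ[ℂ] W, (∀ x y, B (u₁ x) (u₁ y) = B x y) → (∀ x y, B (u₂ x) (u₂ y) = B x y) →
      u₁ * u₂ * u₁⁻¹ * u₂⁻¹ ∈ glZariskiClosure Γ)
    {u : W ≃ₗ[ℂ] W} (hu : LinearEquiv.det u = 1) : u ∈ glZariskiClosure Γ :=
  mem_glZariskiClosure_of_det_eq_one_of_commutators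
    (commutator_mem_glZariskiClosure_of_unitary_commutators hB hBn hcomm) hu

/-- **`[U(h), U(h)] ⊆ Γ^Zar(ℂ) ⇒ SL(W)(ℂ) ⊆ (Γ^Zar)°(ℂ)`** — the form of hypothesis (1) of Katz's
Goursat–Kolchin–Ribet criterion the routes can feed ("`Gⱼ° ⊇ SL(Eⱼ)` on points of the `j`-th projection"):
`SL(W)` is connected (`mem_glIdentityComponent_of_det_eq_one_of_commutators`). [cite: Borel1991, I.2.2 and 18.3]
[cite: Katz1990ESDE, §1.8 Prop. 1.8.2] -/
theorem mem_glIdentityComponent_of_det_eq_one_of_unitary_commutators (hB : B.IsSymm) (hBn : B.Nondegenerate)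
    {Γ : Subgroup (W ≃ₗ[ℂ] W)}
    (hcomm : ∀ u₁ u₂ : W ≃ₗ[ℂ] W, (∀ x y, B (u₁ x) (u₁ y) = B x y) → (∀ x y, B (u₂ x) (u₂ y) = B x y) →
      u₁ * u₂ * u₁⁻¹ * u₂⁻¹ ∈ glZariskiClosure Γ)
    {u : W ≃ₗ[ℂ] W} (hu : LinearEquiv.det u = 1) : u ∈ glIdentityComponent Γ :=
  mem_glIdentityComponent_of_det_eq_one_of_commutators
    (commutator_mem_glZariskiClosure_of_unitary_commutators hB hBn hcomm) hu

/-- The same with the determinant condition on the underlying linear map. [cite: Borel1991, I.2.2 and 18.3] -/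
theorem mem_glIdentityComponent_of_linearMap_det_eq_one_of_unitary_commutators (hB : B.IsSymm)
    (hBn : B.Nondegenerate) {Γ : Subgroup (W ≃ₗ[ℂ] W)}
    (hcomm : ∀ u₁ u₂ : W ≃ₗ[ℂ] W, (∀ x y, B (u₁ x) (u₁ y) = B x y) → (∀ x y, B (u₂ x) (u₂ y) = B x y) →
      u₁ * u₂ * u₁⁻¹ * u₂⁻¹ ∈ glZariskiClosure Γ)
    {u : W ≃ₗ[ℂ] W} (hu : LinearMap.det (u : W →ₗ[ℂ] W) = 1) : u ∈ glIdentityComponent Γ := by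
  refine mem_glIdentityComponent_of_det_eq_one_of_unitary_commutators hB hBn hcomm ?_
  rw [← Units.val_eq_one, LinearEquiv.coe_det, hu]

/-- **Discharge of the named fact `specialLinear_subset_glIdentityComponent_of_unitary_commutators`**
(`GoursatKolchinRibetCriterion` §2: "a unitary group is Zariski-dense in `GL_n(ℂ)`; hence a Zariski closure
containing the unitary commutators contains `SL_n` in its identity component" — stated there with a proof
sketch via Springer 13.3.9 and a `-- TODO(proof)` by the Cayley transform): PROVED, by
`mem_glIdentityComponent_of_det_eq_one_of_unitary_commutators`. [cite: Springer1998, 13.3.9 (ii)]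
[cite: Borel1991, I.2.2, I.2.4 and 18.3] -/
theorem specialLinear_subset_glIdentityComponent_of_unitary_commutators_holds :
    specialLinear_subset_glIdentityComponent_of_unitary_commutators :=
  fun _ _ _ _ _ hB hBn _ hcomm _ hu => mem_glIdentityComponent_of_det_eq_one_of_unitary_commutators hB hBn hcomm hu

section ProjectionConsequences

variable {ι : Type} [Fintype ι] {E : ι → Type} [∀ i, AddCommGroup (E i)]
  [∀ i, Module ℂ (E i)] [∀ i, FiniteDimensional ℂ (E i)]

/-- **The Goursat–Kolchin–Ribet criterion in the shape the routes consume ((1″)), modulo the Katz fact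
ALONE**: `Katz1990_goursatKolchinRibet_specialLinear'.of_unitary_commutators` with its second fact hypothesis
`specialLinear_subset_glIdentityComponent_of_unitary_commutators` discharged. If `|ι| ≥ 2`, `dim Eᵢ ≥ 2`,
for each `i` some non-degenerate hermitian form on `Eᵢ` has all its unitary commutators in
`glZariskiClosure (H.map ρᵢ)`, and (3)–(4) hold on `H`, then
`Π SL(Eᵢ)(ℂ) ⊆ glIdentityComponent (H.map blockDiagHom)`. [cite: Katz1990ESDE, §1.8 Prop. 1.8.2]
[cite: Borel1991, 18.3] -/
theorem Katz1990_goursatKolchinRibet_specialLinear'.of_unitary_commutators'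
    (hK : Katz1990_goursatKolchinRibet_specialLinear') (hι : 2 ≤ Fintype.card ι)
    (hE : ∀ i, 2 ≤ finrank ℂ (E i)) (H : Subgroup (Π i, (E i ≃ₗ[ℂ] E i)))
    (h1 : ∀ i, ∃ B : E i →ₗ⋆[ℂ] E i →ₗ[ℂ] ℂ, B.IsSymm ∧ B.Nondegenerate ∧
      ∀ u₁ u₂ : E i ≃ₗ[ℂ] E i, (∀ x y, B (u₁ x) (u₁ y) = B x y) → (∀ x y, B (u₂ x) (u₂ y) = B x y) →
        u₁ * u₂ * u₁⁻¹ * u₂⁻¹ ∈ glZariskiClosure (H.map (Pi.evalMonoidHom (fun i => E i ≃ₗ[ℂ] E i) i)))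
    (h3 : ∀ i j, i ≠ j → ¬ ∃ (A : E i ≃ₗ[ℂ] E j) (χ : (Π i, (E i ≃ₗ[ℂ] E i)) → ℂ), ∀ s ∈ H,
      (A : E i →ₗ[ℂ] E j) ∘ₗ (s i : E i →ₗ[ℂ] E i) = χ s • ((s j : E j →ₗ[ℂ] E j) ∘ₗ (A : E i →ₗ[ℂ] E j)))
    (h4 : ∀ i j, i ≠ j → ¬ ∃ (A : Module.Dual ℂ (E i) ≃ₗ[ℂ] E j) (χ : (Π i, (E i ≃ₗ[ℂ] E i)) → ℂ), ∀ s ∈ H,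
      (A : Module.Dual ℂ (E i) →ₗ[ℂ] E j) ∘ₗ ((s i).symm : E i →ₗ[ℂ] E i).dualMap =
        χ s • ((s j : E j →ₗ[ℂ] E j) ∘ₗ (A : Module.Dual ℂ (E i) →ₗ[ℂ] E j)))
    (u : Π i, (E i ≃ₗ[ℂ] E i)) (hu : ∀ i, LinearEquiv.det (u i) = 1) :
    blockDiagHom E u ∈ glIdentityComponent (H.map (blockDiagHom E)) :=
  hK.of_unitary_commutators specialLinear_subset_glIdentityComponent_of_unitary_commutators_holds hι hE H h1 h3 h4
    u hu

end ProjectionConsequences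

/-- **Carlson–Toledo's density ⇒ `SL(W)(ℂ) ⊆ (Γ^Zar)°(ℂ)` for unitary `λ`-reflection groups with `λ` of
prime order `p ≥ 7`** (modulo the cited fact `carlsonToledo1999_unitaryReflection_zariskiDense`): under the
hypotheses of Theorem `udensitytheo` — `B` non-degenerate hermitian, `dim W ≥ 2`, `Δ` a `Γ`-stable
`Γ`-transitive spanning set of vectors with `h(δ,δ) = ε = ±1`, `Γ ≤ GL(W)` generated by the complex
`λ`-reflections along `Δ`, `λ^p = 1 ≠ λ` — every determinant-one automorphism of `W` lies in
`glIdentityComponent Γ`. This discharges the `-- TODO` "the algebraic-group consequence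
`SU(W,h) ⊆ (closure of Γ)`" of `UnitaryReflectionGroupZariskiDense` in the stronger complex form, and is the
per-eigenspace hypothesis (1) (form (1′)) of `Katz1990_goursatKolchinRibet_specialLinear` for the monodromy of
the universal family of `p`-cyclic covers (crux K1 of `CyclicUnitaryPowers`). [cite: CarlsonToledo1999, §7 Theorem udensitytheo]
[cite: Borel1991, I.2.2, I.2.4 and 18.3] -/
theorem carlsonToledo1999_unitaryReflection_zariskiDense.mem_glIdentityComponent_of_det_eq_one
    (hCT : carlsonToledo1999_unitaryReflection_zariskiDense) (hB : B.IsSymm) (hBn : B.Nondegenerate)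
    (hW : 2 ≤ finrank ℂ W) {ε : ℂ} (hε : ε = 1 ∨ ε = -1) {l : ℂ} {p : ℕ} (hp : p.Prime) (h7 : 7 ≤ p)
    (hlp : l ^ p = 1) (hl1 : l ≠ 1) {Δ : Set W} (hΔ : ∀ δ ∈ Δ, B δ δ = ε) (hspan : Submodule.span ℂ Δ = ⊤)
    {Γ : Subgroup (W ≃ₗ[ℂ] W)}
    (hΓ : Γ = Subgroup.closure {g : W ≃ₗ[ℂ] W | ∃ δ ∈ Δ, (g : W →ₗ[ℂ] W) = complexReflection B ε l δ})
    (hstab : ∀ g ∈ Γ, ∀ δ ∈ Δ, g δ ∈ Δ) (htrans : ∀ δ ∈ Δ, ∀ δ' ∈ Δ, ∃ g ∈ Γ, g δ = δ')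
    {u : W ≃ₗ[ℂ] W} (hu : LinearEquiv.det u = 1) : u ∈ glIdentityComponent Γ :=
  mem_glIdentityComponent_of_det_eq_one_of_unitary_commutators hB hBn
    (fun _ _ hu₁ hu₂ => commutator_mem_glZariskiClosure_of_prime_order hCT hB hBn hW hε hp h7 hlp hl1 hΔ hspan hΓ
      hstab htrans hu₁ hu₂) hu

/-- The same with `LinearMap.det`. [cite: CarlsonToledo1999, §7 Theorem udensitytheo] [cite: Borel1991, I.2.2 and 18.3] -/
theorem carlsonToledo1999_unitaryReflection_zariskiDense.mem_glIdentityComponent_of_linearMap_det_eq_one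
    (hCT : carlsonToledo1999_unitaryReflection_zariskiDense) (hB : B.IsSymm) (hBn : B.Nondegenerate)
    (hW : 2 ≤ finrank ℂ W) {ε : ℂ} (hε : ε = 1 ∨ ε = -1) {l : ℂ} {p : ℕ} (hp : p.Prime) (h7 : 7 ≤ p)
    (hlp : l ^ p = 1) (hl1 : l ≠ 1) {Δ : Set W} (hΔ : ∀ δ ∈ Δ, B δ δ = ε) (hspan : Submodule.span ℂ Δ = ⊤)
    {Γ : Subgroup (W ≃ₗ[ℂ] W)}
    (hΓ : Γ = Subgroup.closure {g : W ≃ₗ[ℂ] W | ∃ δ ∈ Δ, (g : W →ₗ[ℂ] W) = complexReflection B ε l δ})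
    (hstab : ∀ g ∈ Γ, ∀ δ ∈ Δ, g δ ∈ Δ) (htrans : ∀ δ ∈ Δ, ∀ δ' ∈ Δ, ∃ g ∈ Γ, g δ = δ')
    {u : W ≃ₗ[ℂ] W} (hu : LinearMap.det (u : W →ₗ[ℂ] W) = 1) : u ∈ glIdentityComponent Γ := by
  refine hCT.mem_glIdentityComponent_of_det_eq_one hB hBn hW hε hp h7 hlp hl1 hΔ hspan hΓ hstab htrans ?_
  rw [← Units.val_eq_one, LinearEquiv.coe_det, hu]

end Literature.AlgebraicGeometry.HodgeTheory

end
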